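import Mathlib
import Literature.NumberTheory.LFunctions.Zhang2022.TypedSection04C
import HarnessLib

/-!
# Zhang (2022), §4 pp. 22–23, proofs of Lemmas 4.6–4.7: the zero lattice `iαℤ` of the Rouché
# comparison function `1 − P^{−2w}` — a lattice lemma and the period `iα`, kernel-checked

Topic `Literature/NumberTheory/LFunctions/Zhang2022` (Landau–Siegel audit tree; verdict-neutral).
Y. Zhang, *Discrete mean estimates and the Landau–Siegel zero*, arXiv:2211.02515v1 (2022)
[Zhang2022LandauSiegel] — **an unrefereed manuscript under adjudication**. §4 p. 23, proof of
Lemma 4.7: "the functions `𝒜(ρ+w,ψ)` and `1 − P^{−2w}` have the same number of zeros inside this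
circle, while the later has exactly three zeros inside the same circle which are at `w = 0`,
`w = iα` and `w = −iα`" (`α = π/log P` (2.10), so `P^{−2w} = e^{−2πw/α}` has zero lattice `iαℤ`).
This file proves the two elementary facts about the comparison function that the campaign's
Rouché edges (`Section4Lemma46Rouche`, `Section4Lemma47Rouche`) consume:

* `exists_int_near_of_norm_one_sub_exp_le` — **the lattice lemma**: if `|1 − e^{−2πu}| ≤ η ≤ 1/4`
  then `|u − ik| ≤ 2η` for some `k ∈ ℤ` (`|Re u| ≤ η` from `|e^{−2πRe u} − 1| ≤ η`;
  `dist(Im u, ℤ) ≤ η` from `|sin(π Im u)| ≤ 2η` and Jordan's inequality `2|d| ≤ |sin πd|`);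
* `Pm2w_eq_exp_div`, `Pm2w_add_int_mul` — `P^{−2w} = e^{−2π(w/α)}` and the period `iα`:
  `P^{−2(ikα + w)} = P^{−2w}` (`P^{−2ikα} = e^{−2πik} = 1`), so (4.13) holds verbatim on the
  circles centred at `±iα`; `norm_int_mul_I_mul_alpha` — `|ikα| = |k|α`;
* `zero_near_lattice`, `small_disc_zero_norm_le` — every zero `w` (`|w| < 2α`) of a function
  `𝒜(ρ+·)` with `|𝒜(ρ+w) − (1−P^{−2w})| ≤ η` lies within `2ηα` of `iαℤ`; the unique zero of a
  small disc around `ikα` lies within `2ηα` of `ikα`.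

Nothing here is specific to the manuscript's `𝒜`; nothing about Theorems 1–2 of the source is
stated or implied; nothing here bears on the cell's verdict on (8.24).

## References

* Y. Zhang, arXiv:2211.02515v1 (2022), §4 pp. 22–23, proofs of Lemmas 4.6–4.7; (2.6), (2.10).
  [cite: Zhang2022LandauSiegel, §4 Lemma 4.7 (proof)]
-/

noncomputable section

open Complex Real Set Filter Topology

namespace Literature.NumberTheory.LFunctions.Zhang2022.Section4

open Literature.NumberTheory.LFunctions.Zhang2022.Skeleton

/-! ## The lattice lemma: zeros of `1 − P^{−2w} + O(η)` lie near `iαℤ` -/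

/-- `e^{−2η} ≤ 1 − η` for `0 ≤ η ≤ 1/2`. [folklore] -/
private theorem exp_neg_two_mul_le {η : ℝ} (h0 : 0 ≤ η) (h1 : η ≤ 1 / 2) :
    Real.exp (-(2 * η)) ≤ 1 - η := by
  rw [Real.exp_neg]
  have h4 : 1 + 2 * η ≤ Real.exp (2 * η) := by linarith [Real.add_one_le_exp (2 * η)]
  have h5 : (Real.exp (2 * η))⁻¹ ≤ (1 + 2 * η)⁻¹ := inv_anti₀ (by linarith) h4
  refine h5.trans ?_
  rw [inv_le_iff_one_le_mul₀ (by linarith)]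
  nlinarith

/-- Jordan's inequality in the form `2|d| ≤ |sin(πd)|` for `|d| ≤ 1/2`. [folklore] -/
private theorem two_mul_abs_le_abs_sin_pi_mul {d : ℝ} (hd : |d| ≤ 1 / 2) :
    2 * |d| ≤ |Real.sin (π * d)| := by
  have hπ := Real.pi_pos
  have key : ∀ e : ℝ, 0 ≤ e → e ≤ 1 / 2 → 2 * e ≤ Real.sin (π * e) := by
    intro e he0 he1
    have h := Real.mul_le_sin (x := π * e) (by positivity) (by nlinarith)
    calc 2 * e = 2 / π * (π * e) := by field_simp
      _ ≤ Real.sin (π * e) := h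
  rcases le_or_gt 0 d with hd0 | hd0
  · rw [abs_of_nonneg hd0] at hd ⊢
    exact (key d hd0 hd).trans (le_abs_self _)
  · have hd' : |d| = -d := abs_of_neg hd0
    rw [hd'] at hd ⊢
    have h := key (-d) (by linarith) hd
    simp only [mul_neg, Real.sin_neg] at h
    have h' := h.trans (neg_le_abs _)
    linarith

/-- **The lattice lemma** ("which are at `w = 0`, `w = iα` and `w = −iα`", quantitatively): if
`|1 − e^{−2πu}| ≤ η ≤ 1/4` then `|u − ik| ≤ 2η` for some integer `k` — a point where `1 − e^{−2πu}` is
small lies near the zero lattice `iℤ` (`|Re u| ≤ η` from `|e^{−2πRe u} − 1| ≤ η`; `dist(Im u, ℤ) ≤ η`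
from `|sin(π Im u)| ≤ 2η` and Jordan's inequality). [cite: Zhang2022LandauSiegel, §4 Lemma 4.7 (proof)] -/
theorem exists_int_near_of_norm_one_sub_exp_le {u : ℂ} {η : ℝ} (hη : η ≤ 1 / 4)
    (h : ‖1 - cexp (-(2 * π * u))‖ ≤ η) : ∃ k : ℤ, ‖u - (k : ℂ) * I‖ ≤ 2 * η := by
  have hη0 : 0 ≤ η := le_trans (norm_nonneg _) h
  have hπ := Real.pi_pos
  set a : ℝ := -(2 * π * u.re) with ha
  set θ : ℝ := -(2 * π * u.im) with hθ
  have hsplit : (-(2 * π * u) : ℂ) = (a : ℂ) + I * θ := by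
    apply Complex.ext <;> simp [ha, hθ]
  set z : ℂ := cexp (-(2 * π * u)) with hz
  have hz' : z = Real.exp a * cexp (I * θ) := by
    rw [hz, hsplit, Complex.exp_add, Complex.ofReal_exp]
  have hnorm : ‖z‖ = Real.exp a := by
    rw [hz', norm_mul, Complex.norm_real, Real.norm_of_nonneg (Real.exp_pos a).le,
      Complex.norm_exp_I_mul_ofReal, mul_one]
  -- `|e^a − 1| ≤ η`
  have h1 : |Real.exp a - 1| ≤ η := by
    have := abs_norm_sub_norm_le z 1
    rw [hnorm, norm_one] at this
    rw [norm_sub_rev] at h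
    exact this.trans h
  obtain ⟨h1l, h1r⟩ := abs_le.mp h1
  -- `|a| ≤ 2η`, so `|Re u| ≤ η`
  have ha_le : a ≤ η := by
    have : Real.exp a ≤ Real.exp η := by linarith [Real.add_one_le_exp η]
    exact Real.exp_le_exp.mp this
  have ha_ge : -(2 * η) ≤ a := by
    by_contra hlt
    push Not at hlt
    have h2 : Real.exp a < Real.exp (-(2 * η)) := Real.exp_lt_exp.mpr hlt
    have h3 := exp_neg_two_mul_le hη0 (by linarith)
    linarith
  have hre : |u.re| ≤ η := by
    have : |a| ≤ 2 * η := abs_le.mpr ⟨ha_ge, by linarith⟩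
    rw [ha, abs_neg, abs_mul, abs_of_pos (by positivity : (0:ℝ) < 2 * π)] at this
    have hπ3 : 3 < π := Real.pi_gt_three
    have : |u.re| * (2 * π) ≤ 2 * η := by linarith [mul_comm (2 * π) |u.re|]
    nlinarith [abs_nonneg u.re]
  -- `|e^{iθ} − 1| ≤ 4η`
  have hexp_a : Real.exp (-a) ≤ 2 := by
    calc Real.exp (-a) ≤ Real.exp (1 / 2) := Real.exp_le_exp.mpr (by linarith)
      _ ≤ 2 := by
        have := Real.exp_one_lt_d9
        have h12 : Real.exp (1 / 2) ^ 2 = Real.exp 1 := by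
          rw [← Real.exp_nat_mul]; norm_num
        nlinarith [Real.exp_pos (1 / 2 : ℝ)]
  have hE : ‖cexp (I * θ) - 1‖ ≤ 4 * η := by
    have heq : cexp (I * θ) - 1 = (Real.exp (-a) : ℂ) * (z - 1) + ((Real.exp (-a) : ℂ) - 1) := by
      rw [hz', Real.exp_neg, Complex.ofReal_inv]
      have hne : (Real.exp a : ℂ) ≠ 0 := Complex.ofReal_ne_zero.mpr (Real.exp_pos a).ne'
      field_simp
      ring
    rw [heq]
    have hb1 : ‖(Real.exp (-a) : ℂ) * (z - 1)‖ ≤ 2 * η := by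
      rw [norm_mul, Complex.norm_real, Real.norm_of_nonneg (Real.exp_pos _).le]
      exact mul_le_mul hexp_a (by rw [norm_sub_rev]; exact h) (norm_nonneg _) (by norm_num)
    have hb2 : ‖(Real.exp (-a) : ℂ) - 1‖ ≤ 2 * η := by
      rw [← Complex.ofReal_one, ← Complex.ofReal_sub, Complex.norm_real, Real.norm_eq_abs]
      have heq2 : Real.exp (-a) - 1 = Real.exp (-a) * (1 - Real.exp a) := by
        rw [mul_sub, mul_one, ← Real.exp_add, neg_add_cancel, Real.exp_zero]
      rw [heq2, abs_mul, abs_of_pos (Real.exp_pos _), abs_sub_comm]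
      exact mul_le_mul hexp_a h1 (abs_nonneg _) (by norm_num)
    calc ‖(Real.exp (-a) : ℂ) * (z - 1) + ((Real.exp (-a) : ℂ) - 1)‖
        ≤ ‖(Real.exp (-a) : ℂ) * (z - 1)‖ + ‖(Real.exp (-a) : ℂ) - 1‖ := norm_add_le _ _
      _ ≤ 2 * η + 2 * η := add_le_add hb1 hb2
      _ = 4 * η := by ring
  -- `|sin(π Im u)| ≤ 2η`
  have hsin : |Real.sin (π * u.im)| ≤ 2 * η := by
    rw [Complex.norm_exp_I_mul_ofReal_sub_one, Real.norm_eq_abs, abs_mul, abs_two] at hE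
    have : Real.sin (θ / 2) = -Real.sin (π * u.im) := by
      rw [hθ, show -(2 * π * u.im) / 2 = -(π * u.im) by ring, Real.sin_neg]
    rw [this, abs_neg] at hE
    linarith
  -- the nearest integer to `Im u`
  set k : ℤ := round u.im with hk
  have hd : |u.im - k| ≤ 1 / 2 := abs_sub_round u.im
  have hsin' : |Real.sin (π * (u.im - k))| = |Real.sin (π * u.im)| := by
    have : π * u.im = π * (u.im - k) + k * π := by ring
    rw [this, Real.sin_add_int_mul_pi, abs_mul, abs_zpow, abs_neg, abs_one, one_zpow, one_mul]
  have him : |u.im - k| ≤ η := by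
    have := two_mul_abs_le_abs_sin_pi_mul hd
    rw [hsin'] at this
    linarith
  refine ⟨k, ?_⟩
  calc ‖u - (k : ℂ) * I‖ ≤ |(u - (k : ℂ) * I).re| + |(u - (k : ℂ) * I).im| :=
        Complex.norm_le_abs_re_add_abs_im _
    _ = |u.re| + |u.im - k| := by simp
    _ ≤ η + η := add_le_add hre him
    _ = 2 * η := by ring

/-! ## The comparison function in the unit `α`: `P^{−2w} = e^{−2πw/α}`, period `iα` -/

variable {D : ℕ}

/-- `log P = 𝓛⁹ ≠ 0` and `α·log P = π` (as complex numbers), for `𝓛 > 0`.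
[cite: Zhang2022LandauSiegel, §2 (2.6), (2.10)] -/
theorem alpha_mul_log_bigP (hℓ : 0 < ell D) :
    (alpha D : ℂ) * (Real.log (bigP D) : ℂ) = π := by
  have hL : (Real.log (bigP D) : ℂ) ≠ 0 := by
    rw [bigP, Real.log_exp]; exact_mod_cast (pow_pos hℓ 9).ne'
  rw [alpha, Complex.ofReal_div]
  exact div_mul_cancel₀ _ hL

/-- **`P^{−2w}` in the unit `α`**: `P^{−2w} = exp(−2π·(w/α))` (`α log P = π`).
[cite: Zhang2022LandauSiegel, §4 Lemma 4.6 (proof)] -/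
theorem Pm2w_eq_exp_div (hℓ : 0 < ell D) (w : ℂ) :
    Pm2w D w = cexp (-(2 * π * (w / (alpha D : ℂ)))) := by
  have hα : (alpha D : ℂ) ≠ 0 := by
    rw [Section2.alpha_eq_pi_div_ell9]; exact_mod_cast (div_pos Real.pi_pos (pow_pos hℓ 9)).ne'
  rw [Pm2w_eq_Pw, Lemma46.Pw_def]
  congr 1
  rw [← alpha_mul_log_bigP hℓ]
  field_simp

/-- **Periodicity**: `P^{−2(ikα + w)} = P^{−2w}` (`P^{−2ikα} = e^{−2πik} = 1`), so (4.13) holds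
verbatim on the circles centred at `±iα`. [cite: Zhang2022LandauSiegel, §4 Lemma 4.7 (proof)] -/
theorem Pm2w_add_int_mul (hℓ : 0 < ell D) (k : ℤ) (w : ℂ) :
    Pm2w D ((k : ℂ) * I * (alpha D : ℂ) + w) = Pm2w D w := by
  have hαlog := alpha_mul_log_bigP (D := D) hℓ
  rw [Pm2w_eq_Pw, Pm2w_eq_Pw, Lemma46.Pw_def, Lemma46.Pw_def]
  have : -(2 * ((k : ℂ) * I * (alpha D : ℂ) + w) * (Real.log (bigP D) : ℂ)) =
      ((-k : ℤ) : ℂ) * (2 * π * I) + -(2 * w * (Real.log (bigP D) : ℂ)) := by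
    push_cast
    linear_combination (-(2 : ℂ) * k * I) * hαlog
  rw [this, Complex.exp_add, Complex.exp_int_mul_two_pi_mul_I, one_mul]

/-- `‖ikα‖ = |k|α` — the lattice points `ikα` of the zero set of `1 − P^{−2w}` ("at `w = 0`,
`w = iα` and `w = −iα`"). [cite: Zhang2022LandauSiegel, §4 Lemma 4.7 (proof)] -/
theorem norm_int_mul_I_mul_alpha (hα : 0 ≤ alpha D) (k : ℤ) :
    ‖(k : ℂ) * I * (alpha D : ℂ)‖ = |(k : ℝ)| * alpha D := by
  rw [norm_mul, norm_mul, Complex.norm_intCast, Complex.norm_I, mul_one, Complex.norm_real,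
    Real.norm_of_nonneg hα]


/-! ## Zeros of `1 − P^{−2w} + O(η)` near a zero `ρ` of `𝒜` -/

section NearLattice

variable [NeZero D] (χ : DirichletCharacter ℂ D) (x : Chr D) (ρ : ℂ)

/-- **Zeros lie near the lattice `iαℤ`**: if `|𝒜(ρ+w) − (1−P^{−2w})| ≤ η` on `|w| < 2α`
(`η ≤ 1/8`), every zero `w` of `𝒜(ρ+·)` there satisfies `|w − ikα| ≤ 2ηα` for some `k ∈ ℤ`
(lattice lemma with `u = w/α`, `P^{−2w} = e^{−2πw/α}`). [cite: Zhang2022LandauSiegel, §4 Lemma 4.7 (proof)] -/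
theorem zero_near_lattice {η : ℝ} (hℓ0 : 0 < ell D) (hα : 0 < alpha D) (hη : η ≤ 1 / 8)
    (E412 : ∀ w : ℂ, ‖w‖ < 2 * alpha D → ‖calA χ x (ρ + w) - (1 - Pm2w D w)‖ ≤ η)
    {w : ℂ} (hw : ‖w‖ < 2 * alpha D) (hzero : calA χ x (ρ + w) = 0) :
    ∃ k : ℤ, ‖w - (k : ℂ) * I * (alpha D : ℂ)‖ ≤ 2 * η * alpha D := by
  have h := E412 w hw
  rw [hzero, zero_sub, norm_neg, Pm2w_eq_exp_div hℓ0] at h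
  obtain ⟨k, hk⟩ := exists_int_near_of_norm_one_sub_exp_le (by linarith) h
  refine ⟨k, ?_⟩
  have hα0 : (alpha D : ℂ) ≠ 0 := Complex.ofReal_ne_zero.mpr hα.ne'
  have heq : w - (k : ℂ) * I * (alpha D : ℂ) =
      (w / (alpha D : ℂ) - (k : ℂ) * I) * (alpha D : ℂ) := by
    field_simp
  rw [heq, norm_mul, Complex.norm_real, Real.norm_of_nonneg hα.le]
  exact mul_le_mul_of_nonneg_right hk hα.le

/-- **The zero found in the `k`-th small disc lies within `2ηα` of its centre `ikα`** once
`2ηα + r ≤ α`: it is a zero within `r` of `ikα` and within `2ηα` of SOME lattice point, which must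
then be `ikα`. [cite: Zhang2022LandauSiegel, §4 Lemma 4.7 (proof)] -/
theorem small_disc_zero_norm_le {r η : ℝ} (hα : 0 < alpha D) (hrα : r < alpha D)
    (hsum : 2 * η * alpha D + r ≤ alpha D)
    (near : ∀ w : ℂ, ‖w‖ < 2 * alpha D → calA χ x (ρ + w) = 0 →
      ∃ k : ℤ, ‖w - (k : ℂ) * I * (alpha D : ℂ)‖ ≤ 2 * η * alpha D)
    {k : ℤ} (hk : |k| ≤ 1) {v : ℂ}
    (h : {v' : ℂ | ‖v'‖ < r ∧ calA χ x (ρ + ((k : ℂ) * I * (alpha D : ℂ) + v')) = 0} = {v}) :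
    ‖v‖ ≤ 2 * η * alpha D ∧ calA χ x (ρ + ((k : ℂ) * I * (alpha D : ℂ) + v)) = 0 := by
  have hmem : v ∈ ({v} : Set ℂ) := Set.mem_singleton v
  rw [← h] at hmem
  obtain ⟨hvr, hvz⟩ := hmem
  refine ⟨?_, hvz⟩
  have hnk : ∀ k : ℤ, ‖(k : ℂ) * I * (alpha D : ℂ)‖ = |(k : ℝ)| * alpha D :=
    fun k => norm_int_mul_I_mul_alpha hα.le k
  have hk' : |(k : ℝ)| ≤ 1 := by exact_mod_cast hk
  have hw2 : ‖(k : ℂ) * I * (alpha D : ℂ) + v‖ < 2 * alpha D := by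
    calc ‖(k : ℂ) * I * (alpha D : ℂ) + v‖ ≤ ‖(k : ℂ) * I * (alpha D : ℂ)‖ + ‖v‖ := norm_add_le _ _
      _ < alpha D + alpha D := by
          refine add_lt_add_of_le_of_lt ?_ (hvr.trans hrα)
          rw [hnk]; nlinarith
      _ = 2 * alpha D := by ring
  obtain ⟨k', hk'near⟩ := near _ hw2 hvz
  -- `k' = k`
  have hdist : ‖((k' : ℂ) - (k : ℂ)) * I * (alpha D : ℂ)‖ < alpha D := by
    have heq : ((k' : ℂ) - (k : ℂ)) * I * (alpha D : ℂ) =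
        ((k' : ℂ) * I * (alpha D : ℂ) - ((k : ℂ) * I * (alpha D : ℂ) + v)) + v := by ring
    rw [heq]
    calc ‖((k' : ℂ) * I * (alpha D : ℂ) - ((k : ℂ) * I * (alpha D : ℂ) + v)) + v‖
        ≤ ‖(k' : ℂ) * I * (alpha D : ℂ) - ((k : ℂ) * I * (alpha D : ℂ) + v)‖ + ‖v‖ := norm_add_le _ _
      _ ≤ 2 * η * alpha D + ‖v‖ := by rw [norm_sub_rev]; gcongr
      _ < 2 * η * alpha D + r := by linarith
      _ ≤ alpha D := hsum
  have hkk : k' = k := by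
    have h1 : ‖((k' : ℂ) - (k : ℂ)) * I * (alpha D : ℂ)‖ = |(k' : ℝ) - (k : ℝ)| * alpha D := by
      have := hnk (k' - k)
      push_cast at this
      exact this
    rw [h1] at hdist
    have h2 : |(k' : ℝ) - (k : ℝ)| < 1 :=
      lt_of_mul_lt_mul_right (by linarith : |(k' : ℝ) - (k : ℝ)| * alpha D < 1 * alpha D) hα.le
    have h3 : |((k' - k : ℤ) : ℝ)| < 1 := by push_cast; exact h2
    have h4 : |k' - k| < 1 := by exact_mod_cast h3
    obtain ⟨h5, h6⟩ := abs_lt.mp h4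
    omega
  rw [hkk, add_sub_cancel_left] at hk'near
  exact hk'near

end NearLattice

end Literature.NumberTheory.LFunctions.Zhang2022.Section4
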